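import Summits.BirchSwinnertonDyer.BirchSwinnertonDyer.Theorems.ErratumRoadFiveAuxNormReceptacleDefs
import Summits.BirchSwinnertonDyer.BirchSwinnertonDyer.Theorems.ErratumRoadFiveAuxNormRelativeStabilizerLaw
import HarnessLib

/-!
# Route `ErratumRoadFive` (K2, `p ≥ 5`), crux `EulerHalfNotRamNoInertSetAtFive` (item stmt-BirchSwinnertonDyer-19715),
# line `birth` v15 «birth ⊕ aux_norm graft» (LEAD bsd-line-er5-p1 g3): the leaf stub **S2♭ `stub_relativeStabilizerLaw`**
# with EXACTLY the v15 header (LEAD g3, HOME STATUS 2026-08-28T15:15:19Z), over the Defs module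
# `Theorems/ErratumRoadFiveAuxNormReceptacleDefs.lean` (p643374)
# (cell `bsd-stepL`, width seat `bsd-line-er5-p1-w4` g8; `--supports stmt-BirchSwinnertonDyer-19715`)

The statement is `AuxNormReceptacle.RelativeStabilizerLaw K ι q` (def, v4 §1 of `Lines/aux_norm_receptacle.lean` byte-identical): for
`m₀ ≥ 1`, a prime `ℓ₀ ∤ m₀` inert in `K` with `q ∤ ℓ₀ m₀`, and a generator `σ` of `G_{ℓ₀} = ringClassGalOver ι (ℓ₀m₀) m₀`:
`σ^{ℓ₀+1} = 1`, and every prime `w ∋ q` of `K[ℓ₀m₀]` lies over some `v ∋ q` of `K` with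
`#Stab_{⟨σ⟩}(w) · orderOf [𝔭_v]_{m₀} = orderOf [𝔭_v]_{ℓ₀m₀}`. PROOF = the already landed unfolded theorem
`AuxNormReceptacle.relativeStabilizerLaw` (`Theorems/ErratumRoadFiveAuxNormRelativeStabilizerLaw.lean`, p642411), which rests on
`Literature/NumberTheory/EllipticCurves/RingClassFieldDecompositionGroup.lean` (decomposition group = relative residue degree,
Neukirch I (9.6) + VI (7.3)) and x11b3's `#G_ℓ ∣ ℓ + 1`.

HONEST FRAMING. One-line wrapper; theorems only. Nothing here closes 19715; S1, (C), (O) are separate leaves; no summit statement is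
proved by this seat; BSD is proved for no curve. [cite: GrossLMS1991, §3 (p. 239)] [cite: NeukirchANT1999, Ch. I §9 (9.6); Ch. VI §7 (7.3)]
-/

set_option autoImplicit false
set_option linter.dupNamespace false

noncomputable section

namespace Summit.BirchSwinnertonDyer.BirchSwinnertonDyer.Theorems.AuxNormReceptacle

/-- **Leaf stub S2♭ of line v15 — the relative stabiliser law, PROVED** (header VERBATIM as fixed by the LEAD): for `K` imaginary
quadratic and a rational prime `q`, `AuxNormReceptacle.RelativeStabilizerLaw K ι q` (Gross 1991 §3: `G_ℓ ≃ F_λ^×/F_ℓ^×` of order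
`ℓ + 1`; Neukirch I (9.6) `#G_w = e f`, VI (7.3) the decomposition law).
[cite: GrossLMS1991, §3 (p. 239)] [cite: NeukirchANT1999, Ch. I §9 (9.6); Ch. VI §7 Thm. (7.3)] [cite: Cox2013, §7.D Thm. 7.24, §9.A] -/
theorem stub_relativeStabilizerLaw (K : Type) [Field K] [NumberField K] (ι : K →+* ℂ)
    [∀ j : ℕ, NumberField (Literature.NumberTheory.EllipticCurves.ringClassField K ι j)]
    (hK : Literature.NumberTheory.EllipticCurves.IsImaginaryQuadratic K) (q : ℕ) [Fact q.Prime] :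
    Summit.BirchSwinnertonDyer.BirchSwinnertonDyer.Theorems.AuxNormReceptacle.RelativeStabilizerLaw K ι q :=
  relativeStabilizerLaw hK ι q

end Summit.BirchSwinnertonDyer.BirchSwinnertonDyer.Theorems.AuxNormReceptacle

end
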